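import Literature.Probability.LatticeModels.BoxSineHarmonic
import Mathlib.Analysis.SpecialFunctions.Integrals.Basic
import Mathlib.Analysis.SpecialFunctions.Sqrt
import Mathlib.MeasureTheory.Integral.IntervalIntegral.FundThmCalculus
import Mathlib.Analysis.Complex.ExponentialBounds
import HarnessLib

/-!
# The Poisson kernel of the discrete half-plane in Fourier form

Topic `Literature/Probability/LatticeModels`; discrete potential theory for the Russo–Seymour–Welsh
programme for the critical FK-Ising model after Duminil-Copin–Hongler–Nolin (arXiv:0912.4253,
§3.2), whose harmonic-measure estimates (Lemmas 9–11: "standard results on simple random walks …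
we do not provide a detailed proof") are replaced in the tree by explicit lattice-harmonic
comparison functions (`BoxSineHarmonic.lean` for Lemma 9, `PhantomHarmonicComparison.lean` for
Lemma 11, first item). This file supplies the comparison function for Lemma 11, second item (the
bound `c₄ n/k²` behind a disconnecting segment): the **Poisson kernel of the discrete upper
half-plane**, i.e. the bounded lattice-harmonic function on the rows `y ≥ 0` of `ℤ²` with boundary
values `δ₀` on the row `y = -1`, written as a Fourier integral over the decaying modes
`e^{imθ} ρ(θ)^{y+1}` of the discrete Laplace equation (`ρ + ρ⁻¹ = 2(2 - cos θ)`, the continuum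
version of the modes `dstR` of `BoxSineHarmonic.lean`; Lawler–Limic 2010, §8.1):

  `K_s(m) = hpK s m = (1/π) ∫₀^π cos(mθ) ρ(θ)^s dθ`,  `ρ(θ) = 2 - cos θ - √((2 - cos θ)² - 1)`.

Everything is PROVED; no named fact; [folklore] discrete Fourier analysis and calculus.

* The mode `hpMode = ρ`: `0 < ρ ≤ 1`, `ρ² + 1 = 2(2 - cos θ)ρ` (`hpMode_sq_add_one`), `ρ` is
  continuous and antitone on `[0, π]`, `ρ(θ) ≥ e^{-θ}` (`exp_neg_le_hpMode`, from
  `cos θ + cosh θ ≥ 2`), and on `(0, π)` it is differentiable with **`ρ' = -ρ q`**,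
  `q(θ) = hpQ θ = √((1 + cos θ)/(3 - cos θ))` (`hasDerivAt_hpMode`; `q` is continuous, antitone on
  `[0, π]`, `q(0) = 1`) — the closed form of `sin θ/√((2-cos θ)² - 1)` that removes the apparent
  singularity at `θ = 0`.
* The kernel: `hpK 0 m = δ_{m,0}` (`hpK_zero_eq`), **harmonicity**
  `K_s(m+1) + K_s(m-1) + K_{s+1}(m) + K_{s-1}(m) = 4 K_s(m)` for `s ≥ 1` (`hpK_harmonic`), evenness.
* **Positivity and decay** (`hpK_nonneg`, `hpK_le`): one integration by parts on `(0, π)` (the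
  fundamental theorem of calculus for right derivatives, `ρ^s` being continuous on `[0, π]` but not
  differentiable at `0`) gives `∫₀^π cos(mθ) ρ^s = (1/m) ∫₀^π sin(mθ) g_s`, `g_s = s ρ^s q ≥ 0`
  antitone; and for an antitone nonnegative `g`, `0 ≤ ∫₀^π sin(mθ) g ≤ (2/m) g(0)` by splitting
  `[0, π]` into the `m` half-periods of `sin(mθ)`, on which the integrals alternate in sign and
  decrease in size (`integral_sin_mul_nonneg_le`, `alternating_sum_bounds`). Hence
  `0 ≤ K_s(m) ≤ 2s/(π m²)` for `m ≠ 0`, and `K_s(0) ≥ (1 - e^{-π})/(π s) ≥ 1/(4s)` (`hpK_zero_ge`).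
* On the lattice: `hpPoisson v = K_{v₁+1}(v₀)` is nonnegative, lattice-harmonic at every site with
  `v₁ ≥ 0` (`latticeLaplacian_hpPoisson`), equals `δ₀` on the row `v₁ = -1`, satisfies the one-step
  Harnack inequality `hpPoisson x ≤ 4 hpPoisson (x + e_k)` whenever `x + e_k` lies in the rows
  `≥ 0` (`hpPoisson_le_four_mul`), and the two quantitative bounds `hpPoisson (0, j) ≥ 1/(4(j+1))`,
  `hpPoisson (m, y) ≤ 2(y+1)/(π m²)` (`hpPoisson_axis_ge`, `hpPoisson_le`). These are the inputs of
  the segment barrier of DCHN's Lemma 11, second item (`PhantomSegmentBarrier.lean`).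

## References

* H. Duminil-Copin, C. Hongler, P. Nolin, *Connection probabilities and RSW-type bounds for the
  two-dimensional FK Ising model*, Comm. Pure Appl. Math. 64 (2011) 1165–1198, §3.2 (Lemma 11) —
  bib key `DuminilCopinHonglerNolin2011`.
* G. Lawler, V. Limic, *Random Walk: A Modern Introduction* (2010), §8.1 (Poisson kernel of the
  half-plane and eigenfunction expansions) — bib key `LawlerLimic2010`.
-/

noncomputable section

namespace Literature.Probability.LatticeModels

open Real Set MeasureTheory intervalIntegral

/-! ### The decaying mode `ρ(θ)` of the discrete Laplace equation -/

/-- `c(θ) = 2 - cos θ`, half the trace of the column transfer matrix of the discrete Laplacian.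
[folklore] -/
def hpC (θ : ℝ) : ℝ := 2 - Real.cos θ

/-- The **decaying mode** `ρ(θ) = c - √(c² - 1)`, `c = 2 - cos θ`: the root in `(0, 1]` of
`ρ + ρ⁻¹ = 2(2 - cos θ)`, so that `(m, y) ↦ e^{imθ} ρ^y` is lattice-harmonic
(Lawler–Limic 2010, §8.1; the reciprocal of `dstR` of `BoxSineHarmonic.lean` at the discrete
angles). [folklore] -/
def hpMode (θ : ℝ) : ℝ := hpC θ - Real.sqrt (hpC θ ^ 2 - 1)

/-- `1 ≤ c`. [folklore] -/
theorem one_le_hpC (θ : ℝ) : 1 ≤ hpC θ := by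
  unfold hpC; linarith [Real.cos_le_one θ]

/-- `c ≤ 3`. [folklore] -/
theorem hpC_le_three (θ : ℝ) : hpC θ ≤ 3 := by
  unfold hpC; linarith [Real.neg_one_le_cos θ]

/-- `c² - 1 ≥ 0`. [folklore] -/
theorem hpC_sq_sub_one_nonneg (θ : ℝ) : 0 ≤ hpC θ ^ 2 - 1 := by
  nlinarith [one_le_hpC θ]

/-- `ρ (c + √(c² - 1)) = 1`. [folklore] -/
theorem hpMode_mul_conj (θ : ℝ) : hpMode θ * (hpC θ + Real.sqrt (hpC θ ^ 2 - 1)) = 1 := by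
  have h := Real.sq_sqrt (hpC_sq_sub_one_nonneg θ)
  unfold hpMode
  linear_combination -h

/-- `c + √(c² - 1) > 0`. [folklore] -/
theorem hpC_add_sqrt_pos (θ : ℝ) : 0 < hpC θ + Real.sqrt (hpC θ ^ 2 - 1) :=
  add_pos_of_pos_of_nonneg (by linarith [one_le_hpC θ]) (Real.sqrt_nonneg _)

/-- `ρ = (c + √(c² - 1))⁻¹`. [folklore] -/
theorem hpMode_eq_inv (θ : ℝ) : hpMode θ = (hpC θ + Real.sqrt (hpC θ ^ 2 - 1))⁻¹ :=
  eq_inv_of_mul_eq_one_left (hpMode_mul_conj θ)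

/-- `ρ > 0`. [folklore] -/
theorem hpMode_pos (θ : ℝ) : 0 < hpMode θ := by
  rw [hpMode_eq_inv]; exact inv_pos.2 (hpC_add_sqrt_pos θ)

/-- `ρ ≤ 1` (as `c - 1 ≤ √(c² - 1)` for `c ≥ 1`). [folklore] -/
theorem hpMode_le_one (θ : ℝ) : hpMode θ ≤ 1 := by
  have hc := one_le_hpC θ
  have h : hpC θ - 1 ≤ Real.sqrt (hpC θ ^ 2 - 1) := by
    rw [Real.le_sqrt (by linarith) (hpC_sq_sub_one_nonneg θ)]
    nlinarith
  unfold hpMode; linarith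

/-- **The mode equation** `ρ² + 1 = 2(2 - cos θ) ρ`, i.e. `ρ + ρ⁻¹ = 2c`. [folklore] -/
theorem hpMode_sq_add_one (θ : ℝ) : hpMode θ ^ 2 + 1 = 2 * (2 - Real.cos θ) * hpMode θ := by
  have h := hpMode_mul_conj θ
  have hdef : hpMode θ = hpC θ - Real.sqrt (hpC θ ^ 2 - 1) := rfl
  have hc : hpC θ = 2 - Real.cos θ := rfl
  rw [← hc]
  linear_combination (-1 : ℝ) * h + hpMode θ * hdef

/-- `ρ(0) = 1`. [folklore] -/
theorem hpMode_zero : hpMode 0 = 1 := by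
  norm_num [hpMode, hpC]

/-- `c` is monotone on `[0, π]`. [folklore] -/
theorem hpC_monotoneOn : MonotoneOn hpC (Icc 0 π) := fun a ha b hb hab => by
  unfold hpC; linarith [Real.antitoneOn_cos ha hb hab]

/-- `ρ` is antitone on `[0, π]`. [folklore] -/
theorem hpMode_antitoneOn : AntitoneOn hpMode (Icc 0 π) := by
  intro a ha b hb hab
  rw [hpMode_eq_inv, hpMode_eq_inv]
  have hca := hpC_monotoneOn ha hb hab
  have h1 : hpC a + Real.sqrt (hpC a ^ 2 - 1) ≤ hpC b + Real.sqrt (hpC b ^ 2 - 1) :=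
    add_le_add hca (Real.sqrt_le_sqrt (by nlinarith [one_le_hpC a]))
  exact inv_anti₀ (hpC_add_sqrt_pos a) h1

/-- `ρ` is continuous. [folklore] -/
theorem continuous_hpMode : Continuous hpMode :=
  (continuous_const.sub Real.continuous_cos).sub
    (Real.continuous_sqrt.comp (((continuous_const.sub Real.continuous_cos).pow 2).sub continuous_const))

/-- **`ρ(θ) ≥ e^{-θ}`** for `θ ≥ 0`: `ρ⁻¹ = c + √(c²-1) ≤ cosh θ + sinh θ = e^θ` because
`c = 2 - cos θ ≤ cosh θ` (`two_le_cos_add_cosh`). [folklore] -/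
theorem exp_neg_le_hpMode {θ : ℝ} (hθ : 0 ≤ θ) : Real.exp (-θ) ≤ hpMode θ := by
  rw [hpMode_eq_inv, Real.exp_neg]
  refine inv_anti₀ (hpC_add_sqrt_pos θ) ?_
  have hc : hpC θ ≤ Real.cosh θ := by
    unfold hpC; linarith [two_le_cos_add_cosh hθ]
  have hsinh : 0 ≤ Real.sinh θ := Real.sinh_nonneg_iff.2 hθ
  have hr : Real.sqrt (hpC θ ^ 2 - 1) ≤ Real.sinh θ := by
    have h1 : hpC θ ^ 2 - 1 ≤ Real.sinh θ ^ 2 := by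
      have := Real.cosh_sq θ
      nlinarith [one_le_hpC θ]
    calc Real.sqrt (hpC θ ^ 2 - 1) ≤ Real.sqrt (Real.sinh θ ^ 2) := Real.sqrt_le_sqrt h1
      _ = Real.sinh θ := Real.sqrt_sq hsinh
  rw [← Real.cosh_add_sinh]
  exact add_le_add hc hr

/-- `e^{-sθ} ≤ ρ(θ)^s` for `θ ≥ 0`. [folklore] -/
theorem exp_neg_mul_le_hpMode_pow {θ : ℝ} (hθ : 0 ≤ θ) (s : ℕ) :
    Real.exp (-(s : ℝ) * θ) ≤ hpMode θ ^ s := by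
  rw [show -(s : ℝ) * θ = s * (-θ) by ring, Real.exp_nat_mul]
  exact pow_le_pow_left₀ (Real.exp_pos _).le (exp_neg_le_hpMode hθ) s

/-! ### The logarithmic derivative `q(θ) = √((1 + cos θ)/(3 - cos θ))` -/

/-- `q(θ) = √((1 + cos θ)/(3 - cos θ))`, the closed form of `sin θ / √((2 - cos θ)² - 1)` on
`(0, π)`; `ρ' = -ρ q`. [folklore] -/
def hpQ (θ : ℝ) : ℝ := Real.sqrt ((1 + Real.cos θ) / (3 - Real.cos θ))

/-- `q ≥ 0`. [folklore] -/
theorem hpQ_nonneg (θ : ℝ) : 0 ≤ hpQ θ := Real.sqrt_nonneg _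

/-- `q(0) = 1`. [folklore] -/
theorem hpQ_zero : hpQ 0 = 1 := by
  rw [hpQ, Real.cos_zero]; norm_num

/-- `q ≤ 1`. [folklore] -/
theorem hpQ_le_one (θ : ℝ) : hpQ θ ≤ 1 := by
  rw [hpQ]
  refine Real.sqrt_le_one.2 ?_
  rw [div_le_one (by linarith [Real.cos_le_one θ])]
  linarith [Real.cos_le_one θ]

/-- `q` is continuous. [folklore] -/
theorem continuous_hpQ : Continuous hpQ :=
  Real.continuous_sqrt.comp ((continuous_const.add Real.continuous_cos).div
    (continuous_const.sub Real.continuous_cos) fun θ => by linarith [Real.cos_le_one θ])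

/-- `q` is antitone on `[0, π]` (`u ↦ (1+u)/(3-u)` is increasing and `cos` is antitone). [folklore] -/
theorem hpQ_antitoneOn : AntitoneOn hpQ (Icc 0 π) := by
  intro a ha b hb hab
  have hcos := Real.antitoneOn_cos ha hb hab
  have ha1 := Real.cos_le_one a
  have hb1 := Real.cos_le_one b
  unfold hpQ
  refine Real.sqrt_le_sqrt ?_
  rw [div_le_div_iff₀ (by linarith) (by linarith)]
  nlinarith

/-- On `(0, π)`: `sin θ / √(c² - 1) = q(θ)` (square both sides: `sin² θ (3 - cos θ) =
(1 + cos θ)((2 - cos θ)² - 1)`). [folklore] -/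
theorem sin_div_sqrt_eq_hpQ {θ : ℝ} (h0 : 0 < θ) (hπ : θ < π) :
    Real.sin θ / Real.sqrt (hpC θ ^ 2 - 1) = hpQ θ := by
  have hcos : Real.cos θ < 1 := by
    have := Real.strictAntiOn_cos (a := 0) (b := θ) ⟨le_rfl, Real.pi_pos.le⟩ ⟨h0.le, hπ.le⟩ h0
    rwa [Real.cos_zero] at this
  have hsin : 0 ≤ Real.sin θ := Real.sin_nonneg_of_nonneg_of_le_pi h0.le hπ.le
  have hr : 0 < hpC θ ^ 2 - 1 := by unfold hpC; nlinarith
  have hsq : 0 < Real.sqrt (hpC θ ^ 2 - 1) := Real.sqrt_pos.2 hr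
  have hnonneg : 0 ≤ Real.sin θ / Real.sqrt (hpC θ ^ 2 - 1) := div_nonneg hsin hsq.le
  have hA : (1 + Real.cos θ) / (3 - Real.cos θ) = (Real.sin θ / Real.sqrt (hpC θ ^ 2 - 1)) ^ 2 := by
    rw [div_pow, Real.sq_sqrt hr.le, div_eq_div_iff (by linarith [Real.cos_le_one θ]) hr.ne']
    unfold hpC
    linear_combination (Real.cos θ - 3) * Real.sin_sq_add_cos_sq θ
  rw [hpQ, hA, Real.sqrt_sq hnonneg]

/-- `c' = sin`. [folklore] -/
theorem hasDerivAt_hpC (θ : ℝ) : HasDerivAt hpC (Real.sin θ) θ := by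
  have h := (Real.hasDerivAt_cos θ).const_sub 2
  simp only [neg_neg] at h
  exact h

/-- **`ρ' = -ρ q` on `(0, π)`.** [folklore] -/
theorem hasDerivAt_hpMode {θ : ℝ} (h0 : 0 < θ) (hπ : θ < π) :
    HasDerivAt hpMode (-(hpMode θ * hpQ θ)) θ := by
  have hcos : Real.cos θ < 1 := by
    have := Real.strictAntiOn_cos (a := 0) (b := θ) ⟨le_rfl, Real.pi_pos.le⟩ ⟨h0.le, hπ.le⟩ h0
    rwa [Real.cos_zero] at this
  have hr : 0 < hpC θ ^ 2 - 1 := by unfold hpC; nlinarith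
  have hsq : 0 < Real.sqrt (hpC θ ^ 2 - 1) := Real.sqrt_pos.2 hr
  have h1 : HasDerivAt (fun x => hpC x ^ 2 - 1) (2 * hpC θ * Real.sin θ) θ := by
    have h := ((hasDerivAt_hpC θ).pow 2).sub_const 1
    simpa using h
  have h2 := h1.sqrt hr.ne'
  have h3 := (hasDerivAt_hpC θ).sub h2
  have h4 : HasDerivAt (fun x => hpC x - Real.sqrt (hpC x ^ 2 - 1)) (-(hpMode θ * hpQ θ)) θ := by
    refine h3.congr_deriv ?_
    rw [← sin_div_sqrt_eq_hpQ h0 hπ, hpMode]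
    field_simp
    ring
  exact h4

/-- `(ρ^s)' = -s ρ^s q` on `(0, π)`. [folklore] -/
theorem hasDerivAt_hpMode_pow {θ : ℝ} (h0 : 0 < θ) (hπ : θ < π) (s : ℕ) :
    HasDerivAt (fun x => hpMode x ^ s) (-((s : ℝ) * hpMode θ ^ s * hpQ θ)) θ := by
  have h := (hasDerivAt_hpMode h0 hπ).pow s
  refine h.congr_deriv ?_
  rcases Nat.eq_zero_or_pos s with rfl | hs
  · simp
  · have : hpMode θ ^ s = hpMode θ ^ (s - 1) * hpMode θ := by
      rw [← pow_succ, Nat.sub_add_cancel hs]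
    rw [this]; ring

/-- The integration-by-parts density `g_s = s ρ^s q`. [folklore] -/
def hpG (s : ℕ) (θ : ℝ) : ℝ := (s : ℝ) * hpMode θ ^ s * hpQ θ

/-- `g_s` is continuous. [folklore] -/
theorem continuous_hpG (s : ℕ) : Continuous (hpG s) :=
  (continuous_const.mul (continuous_hpMode.pow s)).mul continuous_hpQ

/-- `g_s ≥ 0`. [folklore] -/
theorem hpG_nonneg (s : ℕ) (θ : ℝ) : 0 ≤ hpG s θ :=
  mul_nonneg (mul_nonneg (Nat.cast_nonneg _) (pow_nonneg (hpMode_pos θ).le _)) (hpQ_nonneg θ)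

/-- `g_s(0) = s`. [folklore] -/
theorem hpG_zero (s : ℕ) : hpG s 0 = s := by
  simp [hpG, hpMode_zero, hpQ_zero]

/-- `g_s` is antitone on `[0, π]` (product of nonnegative antitone functions). [folklore] -/
theorem hpG_antitoneOn (s : ℕ) : AntitoneOn (hpG s) (Icc 0 π) := by
  intro a ha b hb hab
  unfold hpG
  have hρ := hpMode_antitoneOn ha hb hab
  have hq := hpQ_antitoneOn ha hb hab
  have hρs : hpMode b ^ s ≤ hpMode a ^ s := pow_le_pow_left₀ (hpMode_pos b).le hρ s
  have h1 : (s : ℝ) * hpMode b ^ s ≤ (s : ℝ) * hpMode a ^ s := mul_le_mul_of_nonneg_left hρs (Nat.cast_nonneg _)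
  exact mul_le_mul h1 hq (hpQ_nonneg b) (mul_nonneg (Nat.cast_nonneg _) (pow_nonneg (hpMode_pos a).le _))

/-! ### The kernel -/

/-- **The Poisson kernel of the discrete upper half-plane in Fourier form**:
`K_s(m) = (1/π) ∫₀^π cos(mθ) ρ(θ)^s dθ` — the value at `(m, s - 1)` of the bounded lattice-harmonic
function on the rows `y ≥ 0` with boundary values `δ₀` on the row `y = -1` (Lawler–Limic 2010,
§8.1). [folklore] -/
def hpK (s : ℕ) (m : ℤ) : ℝ :=
  π⁻¹ * ∫ θ in (0 : ℝ)..π, Real.cos (m * θ) * hpMode θ ^ s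

/-- The integrands are continuous. [folklore] -/
theorem continuous_cos_mul_hpMode_pow (s : ℕ) (m : ℤ) :
    Continuous fun θ : ℝ => Real.cos (m * θ) * hpMode θ ^ s :=
  (Real.continuous_cos.comp (continuous_const.mul continuous_id)).mul (continuous_hpMode.pow s)

/-- `K` is even in `m`. [folklore] -/
theorem hpK_neg (s : ℕ) (m : ℤ) : hpK s (-m) = hpK s m := by
  simp only [hpK, Int.cast_neg, neg_mul, Real.cos_neg]

/-- **Boundary row**: `K_0(m) = δ_{m,0}`. [folklore] -/
theorem hpK_zero_eq (m : ℤ) : hpK 0 m = if m = 0 then 1 else 0 := by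
  unfold hpK
  simp only [pow_zero, mul_one]
  split_ifs with hm
  · subst hm
    simp only [Int.cast_zero, zero_mul, Real.cos_zero]
    rw [intervalIntegral.integral_const, smul_eq_mul, sub_zero, mul_one, inv_mul_cancel₀ Real.pi_pos.ne']
  · have hm' : (m : ℝ) ≠ 0 := by exact_mod_cast hm
    rw [intervalIntegral.integral_comp_mul_left (fun x => Real.cos x) hm', integral_cos, mul_zero,
      Real.sin_zero, Real.sin_int_mul_pi, sub_zero, smul_zero, mul_zero]

/-- **Harmonicity of the kernel**: `K_s(m+1) + K_s(m-1) + K_{s+1}(m) + K_{s-1}(m) = 4 K_s(m)` for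
`s ≥ 1` (`cos((m±1)θ)` sum to `2 cos θ cos(mθ)`, and `ρ^{s+1} + ρ^{s-1} = 2(2 - cos θ) ρ^s` by the
mode equation). [folklore] -/
theorem hpK_harmonic {s : ℕ} (hs : 1 ≤ s) (m : ℤ) :
    hpK s (m + 1) + hpK s (m - 1) + hpK (s + 1) m + hpK (s - 1) m = 4 * hpK s m := by
  obtain ⟨t, rfl⟩ : ∃ t, s = t + 1 := ⟨s - 1, by omega⟩
  rw [Nat.add_sub_cancel]
  unfold hpK
  have i1 := (continuous_cos_mul_hpMode_pow (t + 1) (m + 1)).intervalIntegrable (μ := volume) 0 π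
  have i2 := (continuous_cos_mul_hpMode_pow (t + 1) (m - 1)).intervalIntegrable (μ := volume) 0 π
  have i3 := (continuous_cos_mul_hpMode_pow (t + 1 + 1) m).intervalIntegrable (μ := volume) 0 π
  have i4 := (continuous_cos_mul_hpMode_pow t m).intervalIntegrable (μ := volume) 0 π
  have i0 := (continuous_cos_mul_hpMode_pow (t + 1) m).intervalIntegrable (μ := volume) 0 π
  rw [← mul_add, ← mul_add, ← mul_add, mul_left_comm]
  congr 1
  rw [← intervalIntegral.integral_add i1 i2, ← intervalIntegral.integral_add (i1.add i2) i3,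
    ← intervalIntegral.integral_add ((i1.add i2).add i3) i4, ← intervalIntegral.integral_const_mul]
  refine intervalIntegral.integral_congr fun θ _ => ?_
  have e1 : ((m + 1 : ℤ) : ℝ) * θ = m * θ + θ := by push_cast; ring
  have e2 : ((m - 1 : ℤ) : ℝ) * θ = m * θ - θ := by push_cast; ring
  simp only [e1, e2, Real.cos_add, Real.cos_sub]
  have hq := hpMode_sq_add_one θ
  linear_combination (Real.cos (m * θ) * hpMode θ ^ t) * hq

/-! ### Positivity and decay: one integration by parts and the alternating blocks -/

/-- **Integration by parts** on `(0, π)`: for `m ≠ 0`,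
`∫₀^π cos(mθ) ρ^s dθ = (1/m) ∫₀^π sin(mθ) g_s(θ) dθ` — from the fundamental theorem of calculus for
`θ ↦ sin(mθ) ρ(θ)^s`, continuous on `[0, π]`, differentiable on `(0, π)`, vanishing at both ends.
[folklore] -/
theorem integral_cos_mul_hpMode_pow_eq {m : ℤ} (hm : m ≠ 0) (s : ℕ) :
    ∫ θ in (0 : ℝ)..π, Real.cos (m * θ) * hpMode θ ^ s =
      (m : ℝ)⁻¹ * ∫ θ in (0 : ℝ)..π, Real.sin (m * θ) * hpG s θ := by
  have hm' : (m : ℝ) ≠ 0 := by exact_mod_cast hm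
  set F : ℝ → ℝ := fun θ => Real.sin (m * θ) * hpMode θ ^ s with hF
  set F' : ℝ → ℝ := fun θ => (m : ℝ) * (Real.cos (m * θ) * hpMode θ ^ s) - Real.sin (m * θ) * hpG s θ with hF'
  have hcont : ContinuousOn F (Icc 0 π) :=
    ((Real.continuous_sin.comp (continuous_const.mul continuous_id)).mul (continuous_hpMode.pow s)).continuousOn
  have hderiv : ∀ x ∈ Ioo 0 π, HasDerivWithinAt F (F' x) (Ioi x) x := by
    intro x hx
    have hsin : HasDerivAt (fun θ : ℝ => Real.sin (m * θ)) (Real.cos (m * x) * m) x := by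
      have h := ((hasDerivAt_id x).const_mul (m : ℝ)).sin
      simp only [id_eq, mul_one] at h
      exact h
    have h := hsin.mul (hasDerivAt_hpMode_pow hx.1 hx.2 s)
    refine (h.congr_deriv ?_).hasDerivWithinAt
    simp only [hF', hpG]
    ring
  have hc1 : Continuous fun θ : ℝ => (m : ℝ) * (Real.cos (m * θ) * hpMode θ ^ s) :=
    continuous_const.mul (continuous_cos_mul_hpMode_pow s m)
  have hc2 : Continuous fun θ : ℝ => Real.sin (m * θ) * hpG s θ :=
    (Real.continuous_sin.comp (continuous_const.mul continuous_id)).mul (continuous_hpG s)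
  have j1 : IntervalIntegrable (fun θ : ℝ => (m : ℝ) * (Real.cos (m * θ) * hpMode θ ^ s)) volume 0 π :=
    hc1.intervalIntegrable (μ := volume) 0 π
  have j2 : IntervalIntegrable (fun θ : ℝ => Real.sin (m * θ) * hpG s θ) volume 0 π :=
    hc2.intervalIntegrable (μ := volume) 0 π
  have hint : IntervalIntegrable F' volume 0 π := j1.sub j2
  have hftc := intervalIntegral.integral_eq_sub_of_hasDeriv_right_of_le Real.pi_pos.le hcont hderiv hint
  have hF0 : F 0 = 0 := by simp [hF]
  have hFπ : F π = 0 := by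
    simp only [hF]
    rw [Real.sin_int_mul_pi, zero_mul]
  rw [hF0, hFπ, sub_zero] at hftc
  have hsplit : ∫ θ in (0 : ℝ)..π, F' θ =
      (m : ℝ) * (∫ θ in (0 : ℝ)..π, Real.cos (m * θ) * hpMode θ ^ s) -
        ∫ θ in (0 : ℝ)..π, Real.sin (m * θ) * hpG s θ := by
    simp only [hF']
    rw [intervalIntegral.integral_sub j1 j2, intervalIntegral.integral_const_mul]
  rw [hsplit] at hftc
  field_simp
  linarith

/-- **Alternating sums with decreasing terms.** If `A ≥ 0` is antitone, then every partial sum of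
`∑ (-1)^j A_j` lies in `[0, A₀]`. [folklore] -/
theorem alternating_sum_bounds {A : ℕ → ℝ} (h0 : ∀ j, 0 ≤ A j) (hmono : ∀ j, A (j + 1) ≤ A j) (n : ℕ) :
    0 ≤ ∑ j ∈ Finset.range n, (-1 : ℝ) ^ j * A j ∧ ∑ j ∈ Finset.range n, (-1 : ℝ) ^ j * A j ≤ A 0 := by
  set S : ℕ → ℝ := fun n => ∑ j ∈ Finset.range n, (-1 : ℝ) ^ j * A j with hS
  have hS1 : ∀ p, S (2 * p + 1) = S (2 * p) + A (2 * p) := fun p => by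
    simp only [hS, Finset.sum_range_succ, Even.neg_one_pow ⟨p, two_mul p⟩, one_mul]
  have hS2 : ∀ p, S (2 * p + 2) = S (2 * p + 1) - A (2 * p + 1) := fun p => by
    have : 2 * p + 2 = 2 * p + 1 + 1 := by ring
    simp only [hS, this, Finset.sum_range_succ (n := 2 * p + 1), Odd.neg_one_pow ⟨p, rfl⟩]
    ring
  have key : ∀ p, 0 ≤ S (2 * p) ∧ S (2 * p + 1) ≤ A 0 := by
    intro p
    induction p with
    | zero => simp [hS]
    | succ p ih =>
      have e1 : 2 * (p + 1) = 2 * p + 2 := by ring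
      have e2 : 2 * (p + 1) + 1 = 2 * (p + 1) + 1 := rfl
      constructor
      · rw [e1, hS2, hS1]
        linarith [ih.1, hmono (2 * p)]
      · rw [show 2 * (p + 1) + 1 = 2 * (p + 1) + 1 from rfl, hS1, e1, hS2]
        linarith [ih.2, hmono (2 * p + 1), h0 (2 * p + 2)]
  change 0 ≤ S n ∧ S n ≤ A 0
  obtain ⟨p, rfl | rfl⟩ := Nat.even_or_odd' n
  · refine ⟨(key p).1, ?_⟩
    have := hS1 p
    linarith [(key p).2, h0 (2 * p)]
  · refine ⟨?_, (key p).2⟩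
    rw [hS1]
    linarith [(key p).1, h0 (2 * p)]

/-- **Half-period decomposition.** For `m ≥ 1` and `g` continuous, nonnegative and antitone on
`[0, π]`: `0 ≤ ∫₀^π sin(mθ) g(θ) dθ ≤ (2/m) g(0)`. The integral over the `j`-th half-period
`[jπ/m, (j+1)π/m]` is `(-1)^j A_j` with `A_j = ∫₀^{π/m} sin(mt) g(t + jπ/m) dt ≥ 0` antitone in
`j`, so the total lies in `[0, A₀]`, and `A₀ ≤ g(0) ∫₀^{π/m} sin(mt) dt = 2 g(0)/m`. [folklore] -/
theorem integral_sin_mul_nonneg_le {m : ℕ} (hm : 1 ≤ m) {g : ℝ → ℝ} (hg : Continuous g)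
    (hg0 : ∀ θ ∈ Icc 0 π, 0 ≤ g θ) (hga : AntitoneOn g (Icc 0 π)) :
    0 ≤ ∫ θ in (0 : ℝ)..π, Real.sin (m * θ) * g θ ∧
      ∫ θ in (0 : ℝ)..π, Real.sin (m * θ) * g θ ≤ 2 / m * g 0 := by
  have hm0 : (0 : ℝ) < m := by exact_mod_cast hm
  set h : ℝ := π / m with hh
  have hhpos : 0 < h := div_pos Real.pi_pos hm0
  have hmh : (m : ℝ) * h = π := by rw [hh]; field_simp
  -- the blocks
  set A : ℕ → ℝ := fun j => ∫ t in (0 : ℝ)..h, Real.sin (m * t) * g (t + j * h) with hA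
  have hcont : ∀ j : ℕ, Continuous fun t : ℝ => Real.sin (m * t) * g (t + j * h) := fun j =>
    (Real.continuous_sin.comp (continuous_const.mul continuous_id)).mul (hg.comp (continuous_id.add continuous_const))
  -- membership of `t + j h` in `[0, π]`
  have hmem : ∀ j : ℕ, j + 1 ≤ m → ∀ t ∈ Icc (0 : ℝ) h, t + j * h ∈ Icc (0 : ℝ) π := by
    intro j hj t ht
    have hj' : ((j : ℝ) + 1) ≤ m := by exact_mod_cast hj
    refine ⟨by nlinarith [ht.1, hhpos.le], ?_⟩
    calc t + j * h ≤ h + j * h := by linarith [ht.2]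
      _ = (j + 1) * h := by ring
      _ ≤ m * h := mul_le_mul_of_nonneg_right hj' hhpos.le
      _ = π := hmh
  have hsin_nonneg : ∀ t ∈ Icc (0 : ℝ) h, 0 ≤ Real.sin (m * t) := by
    intro t ht
    refine Real.sin_nonneg_of_nonneg_of_le_pi (by nlinarith [ht.1]) ?_
    calc (m : ℝ) * t ≤ m * h := mul_le_mul_of_nonneg_left ht.2 hm0.le
      _ = π := hmh
  -- block `j` of the integral is `(-1)^j A_j`
  have hblock : ∀ j : ℕ, ∫ θ in (j * h : ℝ)..((j + 1 : ℕ) : ℝ) * h, Real.sin (m * θ) * g θ = (-1 : ℝ) ^ j * A j := by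
    intro j
    have hshift := intervalIntegral.integral_comp_add_right (fun θ => Real.sin (m * θ) * g θ) (a := 0) (b := h) (j * h)
    rw [zero_add] at hshift
    have hend : ((j + 1 : ℕ) : ℝ) * h = h + j * h := by push_cast; ring
    rw [hend, ← hshift, hA]
    simp only
    rw [← intervalIntegral.integral_const_mul]
    refine intervalIntegral.integral_congr fun t _ => ?_
    have harg : (m : ℝ) * (t + j * h) = m * t + j * π := by
      rw [mul_add, show (m : ℝ) * (j * h) = j * (m * h) by ring, hmh]
    simp only [harg, Real.sin_add_nat_mul_pi]
    ring
  -- the full integral is the alternating sum of the blocks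
  have hsum : ∫ θ in (0 : ℝ)..π, Real.sin (m * θ) * g θ = ∑ j ∈ Finset.range m, (-1 : ℝ) ^ j * A j := by
    have hadj := intervalIntegral.sum_integral_adjacent_intervals (f := fun θ => Real.sin (m * θ) * g θ)
      (μ := volume) (a := fun j : ℕ => (j : ℝ) * h) (n := m)
      (fun k _ => ((Real.continuous_sin.comp (continuous_const.mul continuous_id)).mul hg).intervalIntegrable (μ := volume) _ _)
    simp only [Nat.cast_zero, zero_mul] at hadj
    rw [hmh] at hadj
    rw [← hadj]
    refine Finset.sum_congr rfl fun j _ => ?_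
    rw [← hblock j]
  -- extend the blocks by zero beyond `m - 1`
  set A' : ℕ → ℝ := fun j => if j + 1 ≤ m then A j else 0 with hA'
  have hApos : ∀ j, j + 1 ≤ m → 0 ≤ A j := fun j hj =>
    intervalIntegral.integral_nonneg hhpos.le fun t ht => mul_nonneg (hsin_nonneg t ht) (hg0 _ (hmem j hj t ht))
  have hAmono : ∀ j, j + 2 ≤ m → A (j + 1) ≤ A j := by
    intro j hj
    have k1 : IntervalIntegrable (fun t : ℝ => Real.sin (m * t) * g (t + ((j + 1 : ℕ) : ℝ) * h)) volume 0 h :=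
      (hcont (j + 1)).intervalIntegrable (μ := volume) _ _
    have k2 : IntervalIntegrable (fun t : ℝ => Real.sin (m * t) * g (t + (j : ℝ) * h)) volume 0 h :=
      (hcont j).intervalIntegrable (μ := volume) _ _
    refine intervalIntegral.integral_mono_on hhpos.le k1 k2 fun t ht => ?_
    refine mul_le_mul_of_nonneg_left ?_ (hsin_nonneg t ht)
    refine hga (hmem j (by omega) t ht) (hmem (j + 1) (by omega) t ht) ?_
    push_cast; nlinarith [hhpos.le]
  have hA'0 : ∀ j, 0 ≤ A' j := fun j => by
    simp only [hA']; split_ifs with hj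
    · exact hApos j hj
    · exact le_rfl
  have hA'mono : ∀ j, A' (j + 1) ≤ A' j := fun j => by
    simp only [hA']
    split_ifs with h1 h2 h2
    · exact hAmono j h1
    · exfalso; omega
    · exact hApos j h2
    · exact le_rfl
  have hsum' : ∑ j ∈ Finset.range m, (-1 : ℝ) ^ j * A j = ∑ j ∈ Finset.range m, (-1 : ℝ) ^ j * A' j := by
    refine Finset.sum_congr rfl fun j hj => ?_
    rw [Finset.mem_range] at hj
    simp only [hA', if_pos (show j + 1 ≤ m by omega)]
  obtain ⟨hlo, hhi⟩ := alternating_sum_bounds hA'0 hA'mono m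
  rw [hsum, hsum']
  refine ⟨hlo, hhi.trans ?_⟩
  -- `A'_0 = A_0 ≤ (2/m) g 0`
  have hA'0eq : A' 0 = A 0 := by simp only [hA', if_pos (show 0 + 1 ≤ m by omega)]
  rw [hA'0eq, hA]
  simp only [Nat.cast_zero, zero_mul, add_zero]
  have hle : ∫ t in (0 : ℝ)..h, Real.sin (m * t) * g t ≤ ∫ t in (0 : ℝ)..h, Real.sin (m * t) * g 0 := by
    have k1 : IntervalIntegrable (fun t : ℝ => Real.sin (m * t) * g t) volume 0 h :=
      ((Real.continuous_sin.comp (continuous_const.mul continuous_id)).mul hg).intervalIntegrable (μ := volume) _ _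
    have k2 : IntervalIntegrable (fun t : ℝ => Real.sin (m * t) * g 0) volume 0 h :=
      ((Real.continuous_sin.comp (continuous_const.mul continuous_id)).mul continuous_const).intervalIntegrable (μ := volume) _ _
    refine intervalIntegral.integral_mono_on hhpos.le k1 k2 fun t ht => ?_
    refine mul_le_mul_of_nonneg_left ?_ (hsin_nonneg t ht)
    have htπ : t ∈ Icc (0 : ℝ) π := by
      have := hmem 0 (by omega) t ht
      simpa using this
    exact hga ⟨le_rfl, Real.pi_pos.le⟩ htπ ht.1
  refine hle.trans (le_of_eq ?_)
  rw [intervalIntegral.integral_mul_const, intervalIntegral.integral_comp_mul_left (fun x => Real.sin x) hm0.ne',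
    integral_sin, mul_zero, Real.cos_zero, hmh, Real.cos_pi, smul_eq_mul]
  ring

/-- **Positivity of the kernel**: `K_s(m) ≥ 0`. [folklore] -/
theorem hpK_nonneg (s : ℕ) (m : ℤ) : 0 ≤ hpK s m := by
  -- reduce to `m ≥ 0`
  suffices h : ∀ n : ℕ, 0 ≤ hpK s n by
    rcases Int.eq_nat_or_neg m with ⟨n, rfl | rfl⟩
    · exact h n
    · rw [hpK_neg]; exact h n
  intro n
  rcases Nat.eq_zero_or_pos n with rfl | hn
  · unfold hpK
    simp only [Nat.cast_zero, Int.cast_zero, zero_mul, Real.cos_zero, one_mul]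
    exact mul_nonneg (inv_nonneg.2 Real.pi_pos.le)
      (intervalIntegral.integral_nonneg Real.pi_pos.le fun θ _ => pow_nonneg (hpMode_pos θ).le _)
  · unfold hpK
    have hn' : ((n : ℤ) : ℝ) = n := by simp
    have hn1 : ((n : ℕ) : ℤ) ≠ 0 := by omega
    rw [integral_cos_mul_hpMode_pow_eq hn1 s, hn']
    have hb := (integral_sin_mul_nonneg_le hn (continuous_hpG s) (fun θ _ => hpG_nonneg s θ) (hpG_antitoneOn s)).1
    have : (0 : ℝ) < n := by exact_mod_cast hn
    exact mul_nonneg (inv_nonneg.2 Real.pi_pos.le) (mul_nonneg (inv_nonneg.2 this.le) hb)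

/-- **Decay of the kernel**: `K_s(n) ≤ 2s/(π n²)` for `n ≥ 1`. [folklore] -/
theorem hpK_le (s : ℕ) {n : ℕ} (hn : 1 ≤ n) : hpK s n ≤ 2 * s / (π * (n : ℝ) ^ 2) := by
  unfold hpK
  have hn0 : (0 : ℝ) < n := by exact_mod_cast hn
  have hn' : ((n : ℤ) : ℝ) = n := by simp
  have hn1 : ((n : ℕ) : ℤ) ≠ 0 := by omega
  rw [integral_cos_mul_hpMode_pow_eq hn1 s, hn']
  have hb := (integral_sin_mul_nonneg_le hn (continuous_hpG s) (fun θ _ => hpG_nonneg s θ) (hpG_antitoneOn s)).2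
  rw [hpG_zero] at hb
  calc π⁻¹ * ((n : ℝ)⁻¹ * ∫ θ in (0 : ℝ)..π, Real.sin (n * θ) * hpG s θ)
      ≤ π⁻¹ * ((n : ℝ)⁻¹ * (2 / n * s)) := by
        refine mul_le_mul_of_nonneg_left (mul_le_mul_of_nonneg_left hb (inv_nonneg.2 hn0.le)) (inv_nonneg.2 Real.pi_pos.le)
    _ = 2 * s / (π * (n : ℝ) ^ 2) := by
        field_simp

/-- `K_s(m) ≤ 2s/(π m²)` for every integer `m ≠ 0`. [folklore] -/
theorem hpK_le_of_ne_zero (s : ℕ) {m : ℤ} (hm : m ≠ 0) : hpK s m ≤ 2 * s / (π * (m : ℝ) ^ 2) := by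
  rcases Int.eq_nat_or_neg m with ⟨n, rfl | rfl⟩
  · have hn : 1 ≤ n := by omega
    simpa using hpK_le s hn
  · have hn : 1 ≤ n := by omega
    rw [hpK_neg]
    simpa using hpK_le s hn

/-- `∫₀^π e^{-sθ} dθ = (1 - e^{-sπ})/s` for `s ≠ 0`. [folklore] -/
theorem integral_exp_neg_mul {s : ℝ} (hs : s ≠ 0) :
    ∫ θ in (0 : ℝ)..π, Real.exp (-s * θ) = (1 - Real.exp (-s * π)) / s := by
  rw [intervalIntegral.integral_comp_mul_left (fun x => Real.exp x) (neg_ne_zero.2 hs), integral_exp, mul_zero,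
    Real.exp_zero, smul_eq_mul]
  field_simp
  ring

/-- **The kernel on the axis**: `K_s(0) ≥ (1 - e^{-π})/(π s)` for `s ≥ 1` (from `ρ ≥ e^{-θ}`). [folklore] -/
theorem hpK_zero_ge' {s : ℕ} (hs : 1 ≤ s) : (1 - Real.exp (-π)) / (π * s) ≤ hpK s 0 := by
  have hs0 : (0 : ℝ) < s := by exact_mod_cast hs
  unfold hpK
  simp only [Int.cast_zero, zero_mul, Real.cos_zero, one_mul]
  have hle : ∫ θ in (0 : ℝ)..π, Real.exp (-(s : ℝ) * θ) ≤ ∫ θ in (0 : ℝ)..π, hpMode θ ^ s :=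
    intervalIntegral.integral_mono_on Real.pi_pos.le
      ((Real.continuous_exp.comp (continuous_const.mul continuous_id)).intervalIntegrable (μ := volume) _ _)
      ((continuous_hpMode.pow s).intervalIntegrable (μ := volume) _ _) fun θ hθ => exp_neg_mul_le_hpMode_pow hθ.1 s
  rw [integral_exp_neg_mul hs0.ne'] at hle
  have hexp : Real.exp (-(s : ℝ) * π) ≤ Real.exp (-π) := by
    rw [Real.exp_le_exp]
    have hs1 : (1 : ℝ) ≤ s := by exact_mod_cast hs
    nlinarith [Real.pi_pos, mul_le_mul_of_nonneg_right hs1 Real.pi_pos.le]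
  calc (1 - Real.exp (-π)) / (π * s) = π⁻¹ * ((1 - Real.exp (-π)) / s) := by
        field_simp
    _ ≤ π⁻¹ * ((1 - Real.exp (-(s : ℝ) * π)) / s) := by
        refine mul_le_mul_of_nonneg_left ?_ (inv_nonneg.2 Real.pi_pos.le)
        exact div_le_div_of_nonneg_right (by linarith) hs0.le
    _ ≤ π⁻¹ * ∫ θ in (0 : ℝ)..π, hpMode θ ^ s := mul_le_mul_of_nonneg_left hle (inv_nonneg.2 Real.pi_pos.le)

/-- `e^{-π} ≤ 1/20`. [folklore] -/
theorem exp_neg_pi_le : Real.exp (-π) ≤ 1 / 20 := by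
  have h1 : Real.exp (-π) ≤ Real.exp (-3) := Real.exp_le_exp.2 (by linarith [Real.pi_gt_three])
  have h3 : Real.exp 3 = Real.exp 1 ^ 3 := by rw [← Real.exp_nat_mul]; norm_num
  have he := Real.exp_one_gt_d9
  have h20 : (20 : ℝ) ≤ Real.exp 3 := by
    rw [h3]
    have hp : (2.7182818283 : ℝ) ^ 3 ≤ Real.exp 1 ^ 3 := pow_le_pow_left₀ (by norm_num) he.le 3
    norm_num at hp
    linarith
  have : Real.exp (-3) ≤ 1 / 20 := by
    rw [Real.exp_neg]
    exact inv_le_of_inv_le₀ (by norm_num) (by rw [one_div, inv_inv]; exact h20)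
  exact h1.trans this

/-- **`K_s(0) ≥ 1/(4s)`** for `s ≥ 1`. [folklore] -/
theorem hpK_zero_ge {s : ℕ} (hs : 1 ≤ s) : 1 / (4 * (s : ℝ)) ≤ hpK s 0 := by
  refine le_trans ?_ (hpK_zero_ge' hs)
  have hs0 : (0 : ℝ) < s := by exact_mod_cast hs
  have hπ := Real.pi_lt_d2
  have he := exp_neg_pi_le
  have h4 : π ≤ 4 * (1 - Real.exp (-π)) := by linarith
  rw [div_le_div_iff₀ (by positivity) (by positivity)]
  nlinarith [mul_le_mul_of_nonneg_right h4 hs0.le]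

/-! ### The kernel as a lattice function -/

/-- **The half-plane Poisson kernel on `ℤ²`**: `hpPoisson (m, y) = K_{y+1}(m)` (junk, equal to the
row `-1`, below the row `-1`). It is the lattice-harmonic function on `{y ≥ 0}` with boundary values
`δ₀` on the row `y = -1` that stays bounded. [folklore] -/
def hpPoisson (v : Site 2) : ℝ := hpK (v 1 + 1).toNat (v 0)

/-- `hpPoisson ≥ 0`. [folklore] -/
theorem hpPoisson_nonneg (v : Site 2) : 0 ≤ hpPoisson v := hpK_nonneg _ _

/-- Boundary values: on the row `y = -1`, `hpPoisson = δ₀`. [folklore] -/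
theorem hpPoisson_row_neg_one (v : Site 2) (hv : v 1 = -1) : hpPoisson v = if v 0 = 0 then 1 else 0 := by
  rw [hpPoisson, hv]
  exact hpK_zero_eq (v 0)

/-- **`hpPoisson` is lattice-harmonic on the rows `y ≥ 0`.** [folklore] -/
theorem latticeLaplacian_hpPoisson {v : Site 2} (hv : 0 ≤ v 1) : latticeLaplacian hpPoisson v = 0 := by
  rw [latticeLaplacian_eq, Fin.sum_univ_four]
  have c0 : (v + cornerUnit 0) 0 = v 0 + 1 ∧ (v + cornerUnit 0) 1 = v 1 := by simp [cornerUnit]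
  have c1 : (v + cornerUnit 1) 0 = v 0 ∧ (v + cornerUnit 1) 1 = v 1 + 1 := by simp [cornerUnit]
  have c2 : (v + cornerUnit 2) 0 = v 0 - 1 ∧ (v + cornerUnit 2) 1 = v 1 := by simp [cornerUnit, sub_eq_add_neg]
  have c3 : (v + cornerUnit 3) 0 = v 0 ∧ (v + cornerUnit 3) 1 = v 1 - 1 := by simp [cornerUnit, sub_eq_add_neg]
  simp only [hpPoisson, c0.1, c0.2, c1.1, c1.2, c2.1, c2.2, c3.1, c3.2]
  have hs : 1 ≤ (v 1 + 1).toNat := by omega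
  have h1 : (v 1 + 1 + 1).toNat = (v 1 + 1).toNat + 1 := by omega
  have h2 : (v 1 - 1 + 1).toNat = (v 1 + 1).toNat - 1 := by omega
  rw [h1, h2]
  have h := hpK_harmonic hs (v 0)
  linarith

/-- **One-step Harnack inequality**: if `x + e_k` lies in the rows `y ≥ 0`, then
`hpPoisson x ≤ 4 hpPoisson (x + e_k)` (harmonicity at `x + e_k` and nonnegativity of the other three
neighbours). In particular `hpPoisson (x + e_k) ≥ (1/4) hpPoisson x ≥ (1-w) hpPoisson x` for DCHN's
phantom weight `w ≥ 3/4`. [folklore] -/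
theorem hpPoisson_le_four_mul (x : Site 2) (k : Fin 4) (hx : 0 ≤ (x + cornerUnit k) 1) :
    hpPoisson x ≤ 4 * hpPoisson (x + cornerUnit k) := by
  have h := latticeLaplacian_hpPoisson hx
  rw [latticeLaplacian_eq, sub_eq_zero] at h
  rw [← h]
  have hx' : x = x + cornerUnit k + cornerUnit (k + 2) := by
    rw [cornerUnit_add_two, add_neg_cancel_right]
  calc hpPoisson x = hpPoisson (x + cornerUnit k + cornerUnit (k + 2)) := by rw [← hx']
    _ ≤ ∑ j : Fin 4, hpPoisson (x + cornerUnit k + cornerUnit j) :=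
        Finset.single_le_sum (f := fun j => hpPoisson (x + cornerUnit k + cornerUnit j))
          (fun j _ => hpPoisson_nonneg _) (Finset.mem_univ (k + 2))

/-- **Lower bound on the axis**: `hpPoisson (0, j) ≥ 1/(4(j+1))` for `j ≥ 0`. [folklore] -/
theorem hpPoisson_axis_ge (v : Site 2) (h0 : v 0 = 0) (h1 : 0 ≤ v 1) :
    1 / (4 * ((v 1 : ℝ) + 1)) ≤ hpPoisson v := by
  rw [hpPoisson, h0]
  have hs : 1 ≤ (v 1 + 1).toNat := by omega
  have hcast : (((v 1 + 1).toNat : ℕ) : ℝ) = (v 1 : ℝ) + 1 := by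
    have : (((v 1 + 1).toNat : ℕ) : ℤ) = v 1 + 1 := Int.toNat_of_nonneg (by omega)
    exact_mod_cast this
  have := hpK_zero_ge hs
  rw [hcast] at this
  exact this

/-- **Decay away from the pole**: `hpPoisson (m, y) ≤ 2(y+1)/(π m²)` for `m ≠ 0`, `y ≥ -1`. [folklore] -/
theorem hpPoisson_le (v : Site 2) (h0 : v 0 ≠ 0) (h1 : -1 ≤ v 1) :
    hpPoisson v ≤ 2 * ((v 1 : ℝ) + 1) / (π * (v 0 : ℝ) ^ 2) := by
  rw [hpPoisson]
  have hcast : (((v 1 + 1).toNat : ℕ) : ℝ) = (v 1 : ℝ) + 1 := by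
    have : (((v 1 + 1).toNat : ℕ) : ℤ) = v 1 + 1 := Int.toNat_of_nonneg (by omega)
    exact_mod_cast this
  have := hpK_le_of_ne_zero (v 1 + 1).toNat h0
  rw [hcast] at this
  exact this

end Literature.Probability.LatticeModels
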